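import Literature.Analysis.FluidPDE.TaoY6WhitneySum
import Literature.Analysis.FluidPDE.NSUnconditionalUniquenessOfY6
import HarnessLib

/-!
# Tao (2011/2013), Cor. 11.4 and Cor. 11.1: unconditional uniqueness and bounded enstrophy are theorems

Discharge file for the named facts

* `Literature.Analysis.FluidPDE.tao_unconditional_uniqueness` (`NSUnconditionalUniqueness.lean`;
  T. Tao, *Localisation and compactness properties of the Navier–Stokes global regularity
  problem*, Anal. PDE 6 (2013) = arXiv:1108.1165, Cor. 11.4 = arXiv Cor. 71, p. 36: "Let
  `(u₀, f, T)` be smooth `H¹` data. Then there is at most one almost smooth finite energy solution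
  `(u, p, u₀, f, T)` with this data and with normalised pressure"),
* its velocity form `tao_unconditional_uniqueness_velocity` and the duplicate vendoring
  `tao_finite_energy_velocity_uniqueness` (`NSFiniteEnergyUniqueness.lean`), and
* `tao2011_boundedEnstrophy` (Cor. 11.1 = arXiv Cor. 68).

The printed proof of Cor. 11.4 is: by Cor. 11.1 (bounded enstrophy: Thm. 10.1 enstrophy
localisation + Prop. 9.1 bounded total speed + Lemma 8.1 energy estimate) an almost smooth finite
energy solution with smooth `H¹` data has `u ∈ L^∞_t H¹_x`, i.e. `u ∈ X¹`, and then Cor. 4.3 /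
Thm. 5.4 (iii) (uniqueness of mild = strong `H¹` solutions with normalised pressure, Lemma 4.1)
applies. Every step is a theorem of the tree:

* Lemma 8.1: `tao_finite_energy_smooth_energy_bound_holds` (`NSFiniteEnergySmoothProofs`);
* Prop. 9.1: `tao2011_duhamelNonlinearSpeed_unit_holds`, `tao2011_boundedTotalSpeed_holds`
  (`LerayHopfMildH1`, `LerayHeatTest`, `TaoDuhamelSpeedMajorant/Pointwise`,
  `TaoBoundedTotalSpeedDischarge/Proofs`, `TaoFourierSchur`);
* Thm. 10.1 (annulus/exterior form of Remark 10.6, a priori): `TaoSpeedIntegral`, `TaoMovingCutoff`,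
  `TaoLocalisedEnstrophy`, `TaoEnstrophyIdentity`, `TaoHeatFlux`, `TaoEnstrophyContinuity`,
  `TaoAnnulusHeatFlux`, `TaoAnnulusEnstrophyInequality`, `TaoAnnulusAssembly`, and the nonlinear
  estimate `Y₆`: `tao2011_nonlinearEstimate_holds` (`TaoY6WhitneySum` and the `TaoY6*`,
  `TaoWhitney*`, `LocalVelocityGradient`, `TaoRadialChaining` family);
* Cor. 4.3 / Thm. 5.4 (iii): `tao2011_velocity_eq_of_memSobolevX_holds` (`NSVelocityUniqueness`,
  `NormalisedPressureDischarge`);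
* the assembly: `tao_unconditional_uniqueness_of_nonlinear_duhamel_leaves` (`TaoAnnulusAssembly`),
  packaged as `tao_unconditional_uniqueness_of_nonlinearEstimate` (`NSUnconditionalUniquenessOfY6`).

This file applies the last to `tao2011_nonlinearEstimate_holds`.

## Mathlib / tree search

`lean search 'tao_unconditional_uniqueness_holds|boundedEnstrophy_holds|velocity_uniqueness_holds' --decl`:
no prior discharge (2026-08-15T00:50Z); `tao2011_nonlinearEstimate_holds` (`TaoY6WhitneySum.lean:1336`).

## References

* T. Tao, *Localisation and compactness properties of the Navier–Stokes global regularity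
  problem*, Anal. PDE 6 (2013) 25–107 = arXiv:1108.1165 (`Tao2011`): Cor. 11.4 (arXiv Cor. 71,
  p. 36) with Remark 11.3, Cor. 11.1 (arXiv Cor. 68), Thm. 10.1 + Remark 10.6, Prop. 9.1,
  Lemma 8.1, Cor. 4.3, Thm. 5.4 (iii).
-/

noncomputable section

namespace Literature.Analysis.FluidPDE

/-- **Tao 2011, Cor. 11.4 (Unconditional uniqueness) is a theorem**: for smooth finite energy
`H¹` data there is at most one smooth finite energy solution with normalised pressure on
`[0, T] × ℝ³` (discharge of the named fact `tao_unconditional_uniqueness`). [cite: Tao2011, Cor. 11.4 (arXiv Cor. 71, p. 36) + Remark 11.3] -/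
theorem tao_unconditional_uniqueness_holds : tao_unconditional_uniqueness :=
  (tao_unconditional_uniqueness_of_nonlinearEstimate tao2011_nonlinearEstimate_holds).1

/-- **Tao 2011, Cor. 11.4, velocity form, is a theorem** (discharge of
`tao_unconditional_uniqueness_velocity`). [cite: Tao2011, Cor. 11.4 (arXiv Cor. 71, p. 36) + Remark 11.3] -/
theorem tao_unconditional_uniqueness_velocity_holds : tao_unconditional_uniqueness_velocity :=
  (tao_unconditional_uniqueness_of_nonlinearEstimate tao2011_nonlinearEstimate_holds).2.1

/-- **The duplicate vendoring of Cor. 11.4 is a theorem** (discharge of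
`tao_finite_energy_velocity_uniqueness`, `NSFiniteEnergyUniqueness.lean`). [cite: Tao2011, Cor. 11.4 (arXiv Cor. 71, p. 36)] -/
theorem tao_finite_energy_velocity_uniqueness_holds : tao_finite_energy_velocity_uniqueness :=
  (tao_unconditional_uniqueness_of_nonlinearEstimate tao2011_nonlinearEstimate_holds).2.2

/-- **Tao 2011, Cor. 11.1 (Bounded enstrophy) is a theorem** (discharge of
`tao2011_boundedEnstrophy`). [cite: Tao2011, Cor. 11.1 (arXiv Cor. 68)] -/
theorem tao2011_boundedEnstrophy_holds : tao2011_boundedEnstrophy :=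
  tao2011_boundedEnstrophy_of_nonlinearEstimate tao2011_nonlinearEstimate_holds

end Literature.Analysis.FluidPDE

end
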